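import Literature.AnabelianGeometry.AbsoluteAnabelian.HolomorphicEllipticCuspidalizationPunctureChart
import Literature.AlgebraicTopology.FundamentalGroup.PuncturedTorusCommutator
import Literature.Topology.CoveringSpaces.AbelianDeckMonodromy
import Literature.Topology.CoveringSpaces.PunctureFill
import HarnessLib

/-!
# [AbsTopIII] Cor 2.7 (b).7: abelian finite étale coverings of the punctured torus extend — PROOF

S. Mochizuki, *Topics in absolute anabelian geometry III*, Cor. 2.7 (b), kurims p. 59: "`𝕌 → 𝔼` is
an abelian finite étale covering [which necessarily extends to a covering of the one-point
compactification of `E^top`]".  This file DISCHARGES the cell sub-node (b).7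
`HolomorphicEllipticCuspidalization.AbelianCoverOfPuncturedTorusExtends` of
`HolomorphicEllipticCuspidalization.lean` (plan/L4/SUBDAG-AbsTopIII-Cor-27.md row r10): a finite
covering `q : Y → 𝔼 = T ∖ {0}` of the once-punctured complex torus `T = ComplexTorus Φ` whose deck
group is abelian and transitive on fibres extends to a finite covering of `T`.

Proof (Forster, *Lectures on Riemann Surfaces*, Thm. 5.10 / 8.4 for the ends over a puncture;
Hatcher §1.3 for the monodromy), over the coordinate `p = w ∘ q` of
`HolomorphicEllipticCuspidalizationPunctureChart.lean` (a covering map ON the exterior of a disc):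
* §2 **the loop around the puncture has trivial monodromy** (`degree_eq_one`): the circle
  `s ↦ p(k)·e^{2πis}` pulls back to a loop of `𝔼` inside the punctured square around `0`, whose class
  is a product of commutators (`PuncturedTorus.fromPath_projC_mem_commutator_of_card_eq_two`,
  Hatcher §1.2 p. 51), hence lifts to CLOSED loops in the abelian Galois covering `q`
  (`AbelianDeck.liftPath_one_eq_of_mem_commutator`); by uniqueness of lifts `1` is a period of the
  end through `k` (`ExteriorCoveringDatum.periods`), so its degree is `1` and `p` is injective on
  it (`injOn_component`);
* §3 the ends (connected components of `q⁻¹(W ∖ {0})`) are finitely many open sheets, pairwise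
  disjoint, each mapped bijectively onto `W ∖ {0}` — the hypotheses of the tree's
  `PunctureFill.isCoveringMap_proj`, which adds one point over `0` to each end:
  `extends_fill`, **`abelianCoverOfPuncturedTorusExtends_holds`**.

No named facts; no `sorry`; the `def`s are the covering datum of an end, the (sub)type `PunctureEnd` of ends and their sheets.
HONEST FRAMING: OUR proof of a step of a statement of a refereed paper; typed ≠ endorsed; nothing
here bears on [IUTchIII] Cor. 3.12.

## References

* S. Mochizuki, *Topics in absolute anabelian geometry III*, Cor. 2.7 (b) p. 59. [MochizukiAbsTopIII2015]
* O. Forster, *Lectures on Riemann Surfaces*, GTM 81, Thm. 5.10, Thm. 8.4. [Forster1981]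
* A. Hatcher, *Algebraic Topology*, §1.2 p. 51, §1.3 pp. 70–71. [HatcherAT2002]
-/

noncomputable section

open Set Function Metric Topology unitInterval
open Literature.Geometry.Kaehler (ComplexTorus)
open Literature.Topology.CoveringSpaces
open Literature.AlgebraicTopology.FundamentalGroup

namespace Literature.AnabelianGeometry.AbsoluteAnabelian

namespace HolomorphicEllipticCuspidalization

namespace PunctureProofs

variable {ι : Type} [Fintype ι] {Φ : (ι → ℝ) ≃L[ℝ] ℂ}

/-! ### §2 The loop around the puncture has trivial monodromy: every end has degree one -/

section Degree

variable {Y : Type} [TopologicalSpace Y] (q : Y → puncturedTorus Φ) (hq : IsFiniteEtale q)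
  (hcomm : ∀ φ ψ : deckGroup q, φ * ψ = ψ * φ)
  (htrans : ∀ y y' : Y, q y = q y' → ∃ φ : deckGroup q, (φ : Y ≃ₜ Y) y = y')

/-- The exterior covering datum of the end through `k`. [cite: Forster1981, Thm. 5.10] -/
def datum (k : Y) (hk : toExt Φ (q k : ComplexTorus Φ) ∈ extDisc (rad Φ)⁻¹) :
    ExteriorCoveringDatum Y where
  p y := toExt Φ (q y : ComplexTorus Φ)
  R := (rad Φ)⁻¹
  R_pos := inv_pos.2 (rad_pos Φ)
  cov := isCoveringMapOn_ext q hq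
  k₀ := k
  mem := hk
  finite_fibre := finite_fibre_ext q hq k hk

include hcomm htrans in
/-- **The end through `k` has degree one.**  The circle `s ↦ p(k)·e^{2πis}` is `exp` of the
segment `ζ₀ + 2πi s`; its lift through the datum's lift `ψ` of `exp` is `s ↦ ψ(ζ₀ + 2πi s)`, and its
lift through `q` from `k` is CLOSED because the pulled-back loop of `𝔼 = T ∖ {0}` lies in the
punctured square around `0`, hence is a product of commutators
(`PuncturedTorus.fromPath_projC_mem_commutator_of_card_eq_two`), on which the monodromy of the
abelian Galois covering `q` is trivial (`AbelianDeck.liftPath_one_eq_of_mem_commutator`); by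
uniqueness of lifts `ψ(ζ₀ + 2πi) = ψ(ζ₀)`, so `1` is a period and the degree divides `1`.
[cite: Forster1981, Thm. 5.10; HatcherAT2002, §1.3 pp.70–71] -/
theorem degree_eq_one (k : Y) (hk : toExt Φ (q k : ComplexTorus Φ) ∈ extDisc (rad Φ)⁻¹) :
    (datum q hq k hk).degree = 1 := by
  classical
  set D := datum q hq k hk with hD
  -- the circle in the `w`-plane and its preimage loop in the box coordinates of `T`
  set wc : ℝ → ℂ := fun s ↦ Complex.exp ((D.ζ₀ : ℂ) + s * (2 * Real.pi * Complex.I)) with hwc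
  have hwc_cont : Continuous wc := by
    rw [hwc]; fun_prop
  have hwc_mem : ∀ s : ℝ, wc s ∈ extDisc (rad Φ)⁻¹ := by
    intro s
    have h : (D.ζ₀ : ℂ) + s * (2 * Real.pi * Complex.I) ∈ logHalfPlane D.R := by
      change Real.log D.R < ((D.ζ₀ : ℂ) + s * (2 * Real.pi * Complex.I)).re
      have := D.ζ₀.2
      change Real.log D.R < (D.ζ₀ : ℂ).re at this
      simpa using this
    exact (exp_mem_extDisc_iff D.R_pos).2 h
  have hwc0 : wc 0 = toExt Φ (q k : ComplexTorus Φ) := by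
    simp only [hwc, Complex.ofReal_zero, zero_mul, add_zero]
    exact D.exp_ζ₀
  have hwc1 : wc 1 = wc 0 := by
    simp only [hwc, Complex.ofReal_one, one_mul, Complex.ofReal_zero, zero_mul,
      Complex.exp_add, Complex.exp_two_pi_mul_I, mul_one, Complex.exp_zero]
  -- the loop `ω` in `ι → ℝ` and its image `β` in `𝔼`
  set ωf : ℝ → (ι → ℝ) := fun s ↦ (2 : ℝ) • Φ.symm (wc s)⁻¹ with hωf
  have hwc_ne : ∀ s, wc s ≠ 0 := fun s ↦ ne_zero_of_mem_extDisc (inv_pos.2 (rad_pos Φ)) (hwc_mem s)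
  have hωf_cont : Continuous ωf := by
    rw [hωf]
    refine Continuous.const_smul ?_ (2 : ℝ)
    exact Φ.symm.continuous.comp (hwc_cont.inv₀ hwc_ne)
  let ω : Path (ωf 0) (ωf 0) :=
    { toFun := fun s ↦ ωf s
      continuous_toFun := hωf_cont.comp continuous_subtype_val
      source' := rfl
      target' := by change ωf 1 = ωf 0; rw [hωf]; simp only [hwc1] }
  have hω : ∀ s : I, ω s ∈ closedBall (0 : ι → ℝ) 1 \ {0} := by
    intro s
    have hs := ofExt_spec Φ (hwc_mem s)
    have htgt : (wc s)⁻¹ ∈ (chart0 Φ).target := by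
      rw [← hs.2.2]; exact (chart0 Φ).map_source hs.1.1
    refine ⟨mem_closedBall_zero_iff.2 (norm_two_smul_symm_lt Φ htgt).le, fun h0 ↦ ?_⟩
    have h0' : (2 : ℝ) • Φ.symm (wc s)⁻¹ = 0 := h0
    rw [smul_eq_zero] at h0'
    rcases h0' with h | h
    · norm_num at h
    · exact inv_ne_zero (ne_zero_of_mem_extDisc (inv_pos.2 (rad_pos Φ)) (hwc_mem s))
        (by simpa using h)
  -- the image loop lies in `𝔼` and is a product of commutators there
  have hP0 : PuncturedTorus.projC (0 : ι → ℝ) 0 = ((0 : ComplexTorus Φ) : ι → AddCircle (1 : ℝ)) := by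
    funext i
    simp only [PuncturedTorus.projC_apply, Pi.zero_apply, mul_zero, add_zero, AddCircle.coe_zero]
    rfl
  have hA : {PuncturedTorus.projC (0 : ι → ℝ) 0}ᶜ ⊆ ((puncturedTorus Φ : Set (ComplexTorus Φ)) :
      Set (ι → AddCircle (1 : ℝ))) := by
    intro t ht
    have ht' : t ≠ PuncturedTorus.projC (0 : ι → ℝ) 0 := fun h ↦ ht h
    rw [hP0] at ht'
    exact ht'
  have hmem := PuncturedTorus.fromPath_projC_mem_commutator_of_card_eq_two (0 : ι → ℝ)
    ((puncturedTorus Φ : Set (ComplexTorus Φ)) : Set (ι → AddCircle (1 : ℝ))) hA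
    (card_eq_two Φ) ω hω
  -- the loop `β` of `𝔼`
  set β := VanKampen.liftPath (((puncturedTorus Φ : Set (ComplexTorus Φ)) : Set (ι → AddCircle (1 : ℝ))))
    (ω.map (PuncturedTorus.projC (0 : ι → ℝ)).continuous)
    (fun t ↦ PuncturedTorus.projC_mem 0 _ hA (hω t)) with hβ
  -- `β s` is `ofExt (wc s)`, so `p ∘ (q-lift of β) = wc`
  have hβval : ∀ s : I, ((β s : ↥(puncturedTorus Φ)) : ComplexTorus Φ) = ofExt Φ (wc s) := by
    intro s
    change PuncturedTorus.projC (0 : ι → ℝ) (ωf s) = ((chart0 Φ).symm (wc s)⁻¹ : ι → AddCircle (1 : ℝ))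
    rw [chart0_symm_apply]
  have hqk : q k = β 0 := by
    apply Subtype.ext
    rw [hβval, Set.Icc.coe_zero, hwc0, ofExt_toExt Φ ((toExt_mem_iff Φ _).1 hk).1]
  -- brick B: the `q`-lift of `β` from `k` is closed
  have hclosed := AbelianDeck.liftPath_one_eq_of_mem_commutator (H := deckGroup q)
    hq.isCoveringMap (fun φ e ↦ φ.2 e) hcomm
    (x := β 0) (fun e e' he he' ↦ htrans e e' (he.trans he'.symm)) β hmem k hqk
  -- compare with the lift of `exp` on the segment
  set Λ := hq.isCoveringMap.liftPath β.toContinuousMap k (β.source.trans hqk.symm) with hΛ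
  have hΛ1 : Λ 1 = k := hclosed
  have hΛlift : ∀ s, q (Λ s) = β s := fun s ↦ congrFun (hq.isCoveringMap.liftPath_lifts _ _ _) s
  let Γ : I → logHalfPlane D.R := fun s ↦ ⟨(D.ζ₀ : ℂ) + (s : ℝ) * (2 * Real.pi * Complex.I), by
    change Real.log D.R < ((D.ζ₀ : ℂ) + (s : ℝ) * (2 * Real.pi * Complex.I)).re
    have := D.ζ₀.2
    change Real.log D.R < (D.ζ₀ : ℂ).re at this
    simpa using this⟩
  have hΓcont : Continuous Γ := by
    apply Continuous.subtype_mk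
    fun_prop
  have heqOn : EqOn (D.lift ∘ Γ) Λ univ := by
    refine D.eqOn_of_comp_eqOn isPreconnected_univ ((D.lift.continuous.comp hΓcont).continuousOn)
      Λ.continuous.continuousOn (fun s _ ↦ D.lift_mem_total (Γ s)) (fun s _ ↦ ?_) (fun s _ ↦ ?_)
      (mem_univ 0) ?_
    · -- `Λ s ∈ total`: `p (Λ s) = wc s ∈ extDisc`
      change toExt Φ (q (Λ s) : ComplexTorus Φ) ∈ extDisc (rad Φ)⁻¹
      rw [hΛlift, hβval, toExt_ofExt Φ (hwc_mem s)]
      exact hwc_mem s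
    · change toExt Φ (q (D.lift (Γ s)) : ComplexTorus Φ) = toExt Φ (q (Λ s) : ComplexTorus Φ)
      have h1 : toExt Φ (q (D.lift (Γ s)) : ComplexTorus Φ) = Complex.exp (Γ s : ℂ) := D.p_lift (Γ s)
      rw [h1, hΛlift, hβval, toExt_ofExt Φ (hwc_mem s)]
    · change D.lift (Γ 0) = Λ 0
      rw [hΛ, hq.isCoveringMap.liftPath_zero]
      have : Γ 0 = D.ζ₀ := Subtype.ext (by simp [Γ])
      rw [this]
      exact D.lift_ζ₀
  have hper : (1 : ℤ) ∈ D.periods := by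
    refine D.mem_periods_of_exists ⟨D.ζ₀, ?_⟩
    have h1 : shift D.R 1 D.ζ₀ = Γ 1 := Subtype.ext (by simp [Γ, coe_shift_apply])
    rw [h1]
    have := heqOn (mem_univ 1)
    simp only [comp_apply] at this
    rw [this, hΛ1]
    exact D.lift_ζ₀.symm
  have hdvd := D.mem_periods_iff_degree_dvd.1 hper
  have hdvd' : D.degree ∣ 1 := by exact_mod_cast hdvd
  exact Nat.dvd_one.1 hdvd'

include hcomm htrans in
/-- **Each end is mapped injectively** by `p = w ∘ q` (degree one: `w = root^1`).
[cite: Forster1981, Thm. 5.10] -/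
theorem injOn_component (k : Y) (hk : toExt Φ (q k : ComplexTorus Φ) ∈ extDisc (rad Φ)⁻¹) :
    InjOn (fun y ↦ toExt Φ (q y : ComplexTorus Φ)) (datum q hq k hk).component := by
  intro y hy y' hy' h
  set D := datum q hq k hk
  have hroot : ∀ z : D.component, D.root z = D.p z := fun z ↦ by
    have := D.root_pow z
    rwa [degree_eq_one q hq hcomm htrans k hk, pow_one] at this
  have : D.root ⟨y, hy⟩ = D.root ⟨y', hy'⟩ := by rw [hroot, hroot]; exact h
  exact congrArg Subtype.val (D.root_injective this)

end Degree

/-! ### §3 Filling the puncture -/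

section Fill

variable {Y : Type} [TopologicalSpace Y] (q : Y → puncturedTorus Φ) (hq : IsFiniteEtale q)
  (hcomm : ∀ φ ψ : deckGroup q, φ * ψ = ψ * φ)
  (htrans : ∀ y y' : Y, q y = q y' → ∃ φ : deckGroup q, (φ : Y ≃ₜ Y) y = y')

/-- The total space over the punctured neighbourhood, `p⁻¹{1/r < |w|} = q⁻¹(W ∖ {0})`.
[cite: Forster1981, Thm. 8.4] -/
def total : Set Y := (fun y ↦ toExt Φ (q y : ComplexTorus Φ)) ⁻¹' extDisc (rad Φ)⁻¹

/-- **The ends** of `Y` over the puncture: the connected components of `q⁻¹(W ∖ {0})`.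
[cite: Forster1981, Thm. 8.4] -/
def PunctureEnd : Type := {C : Set Y // ∃ y ∈ total q, C = connectedComponentIn (total q) y}

/-- The sheet of an end. [cite: Forster1981, Thm. 8.4] -/
def sheet (C : PunctureEnd q) : Set Y := C.1

include hq in
/-- Each sheet is open. [cite: Forster1981, Thm. 8.4] -/
theorem isOpen_sheet (C : PunctureEnd q) : IsOpen (sheet q C) := by
  obtain ⟨y, hy, hC⟩ := C.2
  rw [sheet, hC]
  exact (datum q hq y hy).isOpen_component

/-- Distinct sheets are disjoint (components). [cite: Forster1981, Thm. 8.4] -/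
theorem pairwise_disjoint_sheet : Pairwise (Disjoint on sheet q) := by
  intro C C' hne
  obtain ⟨y, hy, hC⟩ := C.2
  obtain ⟨y', hy', hC'⟩ := C'.2
  rw [Function.onFun, sheet, sheet, hC, hC', Set.disjoint_iff]
  rintro z ⟨hz, hz'⟩
  apply hne
  apply Subtype.ext
  rw [hC, hC', connectedComponentIn_eq hz, connectedComponentIn_eq hz']

include hq in
/-- Each sheet maps ONTO `W ∖ {0}`. [cite: Forster1981, Thm. 8.4] -/
theorem image_sheet (C : PunctureEnd q) :
    (fun y ↦ ((q y : ComplexTorus Φ))) '' sheet q C = goodNhd Φ \ {0} := by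
  obtain ⟨y, hy, hC⟩ := C.2
  have himg := (datum q hq y hy).image_component
  change (fun y' ↦ toExt Φ (q y' : ComplexTorus Φ)) '' connectedComponentIn (total q) y =
    extDisc (rad Φ)⁻¹ at himg
  rw [sheet, hC]
  apply Subset.antisymm
  · rintro _ ⟨z, hz, rfl⟩
    have hzt : z ∈ total q := connectedComponentIn_subset _ _ hz
    obtain ⟨h1, h2⟩ := (toExt_mem_iff Φ _).1 hzt
    exact ⟨h1, h2⟩
  · rintro t ⟨ht, ht0⟩
    have htw : toExt Φ t ∈ extDisc (rad Φ)⁻¹ := (toExt_mem_iff Φ t).2 ⟨ht, ht0⟩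
    rw [← himg] at htw
    obtain ⟨z, hz, hzt⟩ := htw
    have hzt' : toExt Φ (q z : ComplexTorus Φ) = toExt Φ t := hzt
    refine ⟨z, hz, toExt_injOn Φ ?_ hzt'⟩
    rw [hzt']
    exact (toExt_mem_iff Φ t).2 ⟨ht, ht0⟩

/-- The sheets exhaust `q⁻¹(W)`. [cite: Forster1981, Thm. 8.4] -/
theorem preimage_subset_iUnion_sheet :
    (fun y ↦ ((q y : ComplexTorus Φ))) ⁻¹' goodNhd Φ ⊆ ⋃ C, sheet q C := by
  intro y hy
  have hyt : y ∈ total q := (toExt_mem_iff Φ _).2 ⟨hy, (q y).2⟩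
  exact mem_iUnion.2 ⟨⟨connectedComponentIn (total q) y, y, hyt, rfl⟩, mem_connectedComponentIn hyt⟩

include hq in
/-- There are finitely many ends (each meets a fixed finite fibre). [cite: Forster1981, Thm. 8.4] -/
theorem finite_end : Finite (PunctureEnd q) := by
  classical
  -- a point of the exterior and its preimage in `W ∖ {0}`
  set w₀ : ℂ := (((rad Φ)⁻¹ + 1 : ℝ) : ℂ) with hw₀
  have hw₀mem : w₀ ∈ extDisc (rad Φ)⁻¹ := by
    change (rad Φ)⁻¹ < ‖w₀‖
    have hr := rad_pos Φ
    rw [hw₀, Complex.norm_real, Real.norm_eq_abs, abs_of_pos (by positivity)]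
    linarith
  obtain ⟨hg, hg0, -⟩ := ofExt_spec Φ hw₀mem
  set d₀ : ↥(puncturedTorus Φ) := ⟨ofExt Φ w₀, hg0⟩
  -- each end meets the fibre over `d₀`
  have hmeet : ∀ C : PunctureEnd q, ∃ z ∈ sheet q C, q z = d₀ := by
    intro C
    have := image_sheet q hq C
    have hd : (d₀ : ComplexTorus Φ) ∈ goodNhd Φ \ {0} := ⟨hg, hg0⟩
    rw [← this] at hd
    obtain ⟨z, hz, hzd⟩ := hd
    exact ⟨z, hz, Subtype.ext hzd⟩
  choose f hf using hmeet
  have hfin : (q ⁻¹' {d₀}).Finite := hq.finite_fibre d₀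
  haveI : Finite ↥(q ⁻¹' {d₀}) := hfin.to_subtype
  refine Finite.of_injective (fun C ↦ (⟨f C, (hf C).2⟩ : ↥(q ⁻¹' {d₀}))) fun C C' h ↦ ?_
  have h' : f C = f C' := congrArg Subtype.val h
  by_contra hne
  have := Set.disjoint_iff.1 (pairwise_disjoint_sheet q hne) ⟨(hf C).1, h' ▸ (hf C').1⟩
  exact this

include hq hcomm htrans in
/-- **[AbsTopIII] Cor 2.7 (b).7 for the given covering**: the filled space is a finite covering of
`T` extending `q`. [cite: MochizukiAbsTopIII2015, Corollary 2.7 (b) p.59] -/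
theorem extends_fill :
    ∃ (Yc : Type) (_ : TopologicalSpace Yc) (qc : Yc → ComplexTorus Φ) (j : Y → Yc),
      IsCoveringMap qc ∧ (∀ t, (qc ⁻¹' {t}).Finite) ∧ IsOpenEmbedding j ∧
        (∀ y, qc (j y) = (q y : ComplexTorus Φ)) ∧
        Set.range j = qc ⁻¹' (puncturedTorus Φ : Set (ComplexTorus Φ)) := by
  classical
  set pT : Y → ComplexTorus Φ := fun y ↦ (q y : ComplexTorus Φ) with hpT
  have hx : ∀ y, pT y ≠ 0 := fun y ↦ (q y).2
  have hcovOn : IsCoveringMapOn pT {(0 : ComplexTorus Φ)}ᶜ :=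
    IsCoveringMapOn.of_isCoveringMap_subtype isOpen_compl_singleton (fun y ↦ hx y) hq.isCoveringMap
  have hcont : Continuous pT := continuous_subtype_val.comp hq.isCoveringMap.continuous
  haveI : Finite (PunctureEnd q) := finite_end q hq
  refine ⟨PunctureFill pT 0 (sheet q), inferInstance, PunctureFill.proj pT 0 (sheet q),
    PunctureFill.inl pT 0 (sheet q), ?_, ?_, PunctureFill.isOpenEmbedding_inl hcont (isOpen_sheet q hq),
    fun y ↦ rfl, PunctureFill.range_inl hx⟩
  · -- covering
    by_cases hne : Nonempty (PunctureEnd q)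
    · exact PunctureFill.isCoveringMap_proj hx hcovOn (isOpen_sheet q hq)
        (pairwise_disjoint_sheet q) (isOpen_goodNhd Φ) (zero_mem_goodNhd Φ) (image_sheet q hq)
        (fun C ↦ by
          obtain ⟨y, hy, hC⟩ := C.2
          intro z hz z' hz' h
          rw [sheet, hC] at hz hz'
          exact injOn_component q hq hcomm htrans y hy hz hz' (congrArg (toExt Φ) h))
        (preimage_subset_iUnion_sheet q)
    · -- no end: nothing over `W`, and `proj = pT` is a covering away from `0`
      rw [not_nonempty_iff] at hne
      intro t
      by_cases ht : t = 0
      · subst ht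
        have hempty : PunctureFill.proj pT 0 (sheet q) ⁻¹' goodNhd Φ = ∅ := by
          rw [Set.eq_empty_iff_forall_notMem]
          intro z hz
          rcases PunctureFill.inl_or_inr pT 0 (sheet q) z with ⟨y, rfl⟩ | ⟨C, rfl⟩
          · rw [mem_preimage, PunctureFill.proj_inl] at hz
            obtain ⟨C, -⟩ := mem_iUnion.1 (preimage_subset_iUnion_sheet q hz)
            exact hne.elim C
          · exact hne.elim C
        haveI : IsEmpty ↥(PunctureFill.proj pT 0 (sheet q) ⁻¹' {(0 : ComplexTorus Φ)}) := by
          refine ⟨fun z ↦ ?_⟩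
          have hz : PunctureFill.proj pT 0 (sheet q) z.1 ∈ goodNhd Φ := by
            rw [show PunctureFill.proj pT 0 (sheet q) z.1 = 0 from z.2]
            exact zero_mem_goodNhd Φ
          have : z.1 ∈ PunctureFill.proj pT 0 (sheet q) ⁻¹' goodNhd Φ := hz
          rw [hempty] at this
          exact this
        exact IsEvenlyCovered.of_preimage_eq_empty _
          ((isOpen_goodNhd Φ).mem_nhds (zero_mem_goodNhd Φ)) hempty
      · exact PunctureFill.isCoveringMapOn_proj_compl hx hcont (isOpen_sheet q hq) hcovOn t ht
  · -- finite fibres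
    intro t
    by_cases ht : t = 0
    · subst ht
      refine (Set.finite_range (PunctureFill.inr pT 0 (sheet q))).subset fun z hz ↦ ?_
      rcases PunctureFill.inl_or_inr pT 0 (sheet q) z with ⟨y, rfl⟩ | ⟨C, rfl⟩
      · exact absurd hz (hx y)
      · exact mem_range_self C
    · refine ((hq.finite_fibre ⟨t, ht⟩).image (PunctureFill.inl pT 0 (sheet q))).subset fun z hz ↦ ?_
      rcases PunctureFill.inl_or_inr pT 0 (sheet q) z with ⟨y, rfl⟩ | ⟨C, rfl⟩
      · refine ⟨y, ?_, rfl⟩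
        have : pT y = t := hz
        exact Subtype.ext this
      · exact absurd (Eq.symm hz) ht

end Fill

end PunctureProofs

/-- **[AbsTopIII] Cor 2.7 (b).7, DISCHARGED**: a finite étale covering of the once-punctured complex
torus whose deck group is abelian and transitive on fibres extends to a finite covering of the
torus ("an abelian finite étale covering [which necessarily extends to a covering of the one-point
compactification of `E^top`]"). [cite: MochizukiAbsTopIII2015, Corollary 2.7 (b) p.59] -/
theorem abelianCoverOfPuncturedTorusExtends_holds :
    Literature.AnabelianGeometry.AbsoluteAnabelian.HolomorphicEllipticCuspidalization.AbelianCoverOfPuncturedTorusExtends := by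
  intro ι _ Φ Y _ q hq hcomm htrans
  exact PunctureProofs.extends_fill q hq hcomm htrans

end HolomorphicEllipticCuspidalization

end Literature.AnabelianGeometry.AbsoluteAnabelian

end
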